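import Literature.MathematicalPhysics.QuantumFieldTheory.Balaban1983to89.T4LipschitzCutoff

/-!
# `Balaban1983to89.T4LipschitzLedger` — node U5b, design row T4-U5b.E2 (iii) (η): THE REALIZED LIPSCHITZ SLOT LEDGER —
the integration step that `T4LipschitzCutoff` leaves to node U5b («Integrating it against run A's measure is node U5b's
business (monotonicity of the integral)», §2 of that module), with the owner's instantiation rules R-η-1 / R-η-2 of the
companion record `t4/T4-EST-U5bE2.md` §5 enforced by the kernel (cell `pub-balaban`, journal row T4-U5b.E2-ETA-LEDGER°;
kernel bookkeeping + Bochner-integral monotonicity, imports `T4LipschitzCutoff` only; companion record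
`t4/T4-EST-U5bE2.md` §6)

HONEST FRAMING (cell `pub-balaban`, T4-DAG PAGE 1).  The cell's T4 target is the existence AND uniqueness of the
continuum limit of Bałaban's unit-scale averaged loop expectations on a finite torus — strictly beyond ultraviolet
stability ([Balaban1989LargeFieldII] Thm 1 p. 355), NOT the Yang–Mills mass gap, NOT the Clay problem.  NOTHING of the
run-A/run-B comparison is printed: the manuscripts construct ONE run, with SHARP characteristic functions throughout;
design (η) — Lipschitz cut-off profiles `χ(u/θ)` in place of `χ({u < θ})` — is a NON-PRINTED PROCEDURE admitted by the
node owner as design (iii) of row T4-U5b.E2 (record §5.3) and priced BY NAME by `T4LipschitzCutoff` (t4-ne7c-p2).  That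
module types the constructor `shellWeightBound_of_lipProfile`: two `LipSlotLedger`s (one per run) + `SiblingSuppression`
in both runs + the summable two-run width `ρ` + the union bounds ⇒ the literal `T4IndicatorShell.ShellWeightBound`, and
proves the POINTWISE mismatch bounds of one slot (`LipProfile.profile_sub_min_le_shell`, `minPiece_profile_mul_le`),
but leaves `LipSlotLedger` itself — the INTEGRATED, per-term form — as a hypothesis SHAPE («cell bookkeeping, NOT
PRINTED»).  THIS LEAF DISCHARGES THAT SHAPE: it fixes a measure-theoretic REPRESENTATION CONVENTION for the term weights
of a run (`TermRepr`: term `τ ∈ T K` at source `t` is `∫ (∏_{i<m} p_i(v)) · R(v) dμ`, the `p_i` the term's profile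
slot factors of either polarity — small-field `χ_a(u_i(v)/θ_i)` or large-field `1 − χ_a(u_i(v)/θ_i)` — with measurable
tested variables `u_i`, thresholds `θ_i > 0`, ages `a ≤ min(N, K)`, and a nonnegative integrable remainder `R`
collecting every other factor), DEFINES the refined shell pieces and the siblings of every slot as Bochner integrals
(nothing postulated), and PROVES: the five fields of `LipSlotLedger` (`lipSlotLedger_of_repr`) from the representation
and the two-run sup-closeness of the tested variables in relative form (`SupClose`, node U1b's (F∞) — a BINDER); the
union bound WITH EQUALITY and the core identity `X − shX = ∫ (∏ min(p^A_i, p^B_i)) · R` (`sum_pieceW_eq_shellW`,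
`repr_sub_shellW`); the symmetric statement for the other run (the min-core is common to both runs); the CORE SANDWICH:
an a.e. two-sided sandwich of the two runs' remainders on the good terms (the output format of
`T4RecentScale.density_sandwich` for the remaining factor ledgers — a BINDER) gives the `hcore` input of
`T4IndicatorShell.good_ref` / `cauchy_of_relWeightBound_shell` for the refined families (`core_sandwich`); and the two
corollaries BY NAME — `shellWeightBound_of_repr` (⇒ `ShellWeightBound` with weight `K ↦ Σ_{a≤N} n_a·lipWeight L S ρ a K`,
via `T4LipschitzCutoff.shellWeightBound_of_lipProfile`) and `cauchy_of_repr` (+ an NE7b output `RelWeightBound`, the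
remainder sandwiches, positivity and `Summable δ` ⇒ the conclusions of `T4IndicatorShell.cauchy_of_relWeightBound_shell`).
After this leaf the (η) member's SHELL LEDGER reads from two honest binders — (F∞) `SupClose` [node U1b, NOT PRINTED] and
`SiblingSuppression` [NE7b species, NOT PRINTED as a ratio statement] — and its core sandwich from one, the remainder
sandwich [node U5b's factor ledgers, `T4RecentScale` format]; the end-to-end corollary adds the NE7b output
`RelWeightBound`, the smallness `W + Wsh < 1`, positivity, the partition-function identities and `Summable δ`, all as
binders; the representation convention is definitional.  NOT summit progress, NOT a proof of NE7c or
NE7b, NOT a statement about Bałaban's densities: every `def …`/`structure … : Prop` below is a hypothesis SHAPE or a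
definition, every theorem is finite-sum algebra, order arithmetic in `[0, 1]`, or monotonicity / linearity of the
Bochner integral ([folklore]).  Rung (B)+1 scoping only (finite torus; NOT infinite volume / mass gap / Clay).
v1.1 (APPEND-ONLY; §§1–4 byte-identical to v1 p185373): §5 SANITY — a toy NON-DEGENERATE inhabitant of
`TermRepr` ×2 + `SupClose` + `SiblingSuppression` ×2 on which `shellWeightBound_of_repr` fires (shell part `(1/2)^K/4 > 0`
at every cutoff, band weight `(1/2)^K`): the binders are jointly satisfiable by non-trivial data (non-vacuity; a toy,
NOT Bałaban's terms).

THE OWNER'S RULES MADE KERNEL SHAPES (record `t4/T4-EST-U5bE2.md` §5.3).  R-η-1: the sibling a small-field slot's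
mismatch is charged against is the SHELL-RESTRICTED one — run A's term with the slot's factor replaced by the same-run
indicator `1[(1 − κ − ρ_j)θ_i ≤ u^A_i < θ_i]` (here `Pol.shell .small`, from `LipProfile.profile_sub_min_le_shell`), never
the unrestricted `largeInd` form, because configurations outside the support of the term's own slot condition are
represented by nothing printed.  R-η-2: a large-field slot `1 − χ_a(u/θ)` is booked by the run's OWN shell
`1[(1 − κ)θ_i ≤ u^A_i < (1 + ρ_j)θ_i]` (`Pol.shell .large`, `Pol.fac_sub_min_le`), inside the closure of the support
`u^A_i > (1 − κ)θ_i` of the slot's own factor.  Both shells are SINGLE-RUN quantities; no object of run B survives on the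
right-hand sides.

CITATION HEADER (lean-in-tree rule 2026-08-18).  This lineage (`b2b-balaban-pv07`) read the RENDERS
`b2b-balaban-ref1/pages/1989-cmp122-large-field-I/1989-cmp122-large-field-I-p019-x2.png` (journal p. 193 of T. Bałaban,
*Large field renormalization. I. The basic step of the ℝ operation*, Commun. Math. Phys. **122** (1989) 175–202
[Balaban1989LargeFieldI], cell paper B15; PDF page = journal page − 174) and
`…/1988-cmp119-convergent-renormalization/1988-cmp119-convergent-renormalization-p015-x2.png` (journal p. 257 of
T. Bałaban, *Convergent renormalization expansions for lattice gauge theories*, Commun. Math. Phys. **119** (1988) 243–285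
[Balaban1988Convergent], cell paper B14; PDF page = journal page − 242) as images (gen 6, module `T4IndicatorShell`;
re-read gen 13, certificate `HOME/b2b-balaban-pv07/xread-T4LipschitzCutoff/XREAD-T4LipschitzCutoff-v1.md`) and quotes
VERBATIM, for CONTEXT and SHAPE only:
* B14 p. 257: *"ρ_k(V_k) = Σ_{{Ω_j},{Λ_j}} χ_k(Ω_k)T_k({Ω_j},{Λ_j}) exp A_k(1/g_k², U_k) , (2.18) where the summation is over
  the admissible sequences of domains."* and *"Basically this operation is a composition of integrations restricted to
  large field regions in successive scales, and multiplications by characteristic functions, δ-functions defining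
  renormalization transformations,"* — the SHAPE behind `TermRepr`: a term is an iterated positive integral of a product
  of characteristic-function factors times the remaining nonnegative density; under design (η) the characteristic
  functions of the background-mediated slots are profiles.
* B15 p. 193: *"This condition is enough to get the exponential small factor, estimating in the usual way the Wilson
  action. Thus 1 − χ_{k,Λ} is a large field function, and we exclude from Z the components with this function."* — the
  printed TEMPLATE of `SiblingSuppression` (a region where a regularity condition fails at a lowered threshold carries
  the large-field small factor); and *"All the above transformations preserve the k^{th} density ρ_k, they change only the
  representation of this density."* — refinements of the representation change no integral (here: `sum_refT_refVal` of
  `T4IndicatorShell`, and the union identity `sum_pieceW_eq_shellW`).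
The manuscripts are quoted for CONTEXT and SHAPE only; no disputed estimate of theirs is used anywhere below, and
nothing printed is asserted.  ABSOLUTE RULE respected: no internally-minted statement enters as a cited fact — (F∞),
`SiblingSuppression`, `RelWeightBound`, the remainder sandwich, positivity and `Summable δ` are BINDERS of the theorems.

THE ROW SERVED (journal `CLAIMS.log` 2026-08-19, unit `b2b-balaban-pv07-g14`, self-proposed under the yield clause of
T4-DAG v17 §8 Q24 as the continuation of design row T4-U5b.E2 (iii); T4-DAG v17 §8 Q25(iii) «for the node owner (pv07
lineage) to rule»): "T4-U5b.E2-ETA-LEDGER° | U5b/U5.E | PROVE (kernel, M) | the integration step of design (η): realized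
term representation ⇒ `LipSlotLedger` + union bound + core identity + core sandwich ⇒ `ShellWeightBound` /
`cauchy_of_relWeightBound_shell` by name | `T4LipschitzCutoff` (ne7c-p2), `T4IndicatorShell` (pv07), `T4RecentScale`
(format of the remainder sandwich) | M".

## What is typed and what is proved

§1 [folklore] POLARITY AND THE POINTWISE SLOT CALCULUS over plain data `u θ : ℕ → ℝ`: `Pol` (small / large), `Pol.fac`
(`x ↦ x` / `x ↦ 1 − x` applied to the profile value), `Pol.shell` (the same-run shell of the polarity), `Pol.fac_sub_min_le`
(THE MISMATCH VALUE of either polarity is `≤ L·(Δ/θ) ×` its same-run shell — small: `profile_sub_min_le_shell` verbatim;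
large: proved here); `facAt`, `coreAt`, `pieceAt` (= `T4LipschitzCutoff.minPiece` of the factor family with the min-core),
`sibAt` (shell × `T4LipschitzCutoff.sibling`); bounds in `[0, 1]`, symmetry of the core (`coreAt_comm`), the split
`sum_pieceAt_eq`, and `pieceAt_le_sibAt`: under `|u^A_i − u^B_i| ≤ w·θ_i`, `pieceAt_i ≤ L(a_i)·w·sibAt_i`; the
dominations `Pol.shell_small_le_largeInd_lowered` / `Pol.shell_large_le_layer` by the §6 shapes of `T4LipschitzCutoff`.
§2 [folklore] MEASURABILITY / INTEGRABILITY: a Lipschitz profile is continuous (`LipProfile` ⇒ `continuous_profile`);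
the slot factors, core, pieces and siblings are measurable in the integration variable for measurable tested variables;
a `[0, 1]`-valued measurable factor times an integrable remainder is integrable (`integrable_unitInterval_mul`).
§3 [folklore] THE REALIZED LEDGER: `TermRepr` (representation convention of one run, a `structure … : Prop`), `SupClose`
((F∞) in relative form by LEVEL `K − a`, a.e.; symmetric: `SupClose.symm`), the realized weights `pieceW` (slot `σ`:
the sum over the term's factors assigned to `σ` of `∫ pieceAt_i · R`), `sibW` (same with `sibAt_i` at width `ρ(K − a_i)`),
`coreW`, `shellW`; `lipSlotLedger_of_repr : TermRepr … → SupClose … → LipSlotLedger l₀ T X N n (pieceW …) (sibW …) Lχ ρ`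
(all five fields: nonnegativity, `≤` the term, OFF-BAND VANISHING from the age cap `a_i ≤ K`, sibling nonnegativity, and
the band inequality by `integral_mono_ae`); `sum_pieceW_eq_shellW` (the union bound is an IDENTITY, by
`Finset.sum_fiberwise_of_maps_to` — no injectivity of the slot assignment is needed); `shellW_nonneg`, `shellW_le`,
`repr_sub_shellW` (`X − shellW = coreW`).
§4 [folklore] TWO RUNS: `coreW_comm` (run B's core integral against `R^B` written with the factors in either order);
`core_sandwich` (a.e. `e^{c_K − vol·δ_K} R^A ≤ R^B ≤ e^{c_K + vol·δ_K} R^A` on the good terms ⇒ the literal `hcore` of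
`T4IndicatorShell.good_ref` for `shA := shellW^A`, `shB := shellW^B`, via `T4HybridMatching.integral_sandwich` with the
common nonnegative core factor); `shellWeightBound_of_repr` (⇒ `ShellWeightBound l₀ T A B shellW^A shellW^B
(K ↦ Σ_{a≤N} n_a · lipWeight Lχ S ρ a K)` by `shellWeightBound_of_lipProfile`, the Lipschitz constants' signs from
`LipProfile.L_pos`); `cauchy_of_repr` (END TO END through `cauchy_of_relWeightBound_shell`: matching modulo constants with
remainders `hybridDelta vol δ (W + Wsh)`, their summability, the Cauchy property and uniform convergence of the generating
functions on `|t| ≤ l₀`, for the SAME partition functions).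

§5 [folklore] SANITY (v1.1): the toy inhabitant (`Sanity.termRepr_A/_B`, `supClose`, `siblingSuppression_A/_B`,
`shellWeightBound_toy`, `shellW_A_pos`, `bandWeight`) — non-vacuity of the binders of §3–§4; no estimate, no print.

CONSISTENCY WITH `T4LipschitzCutoff` v1.2 §6 (t4-ne7c-p2, advisories A1/A2, landed while this leaf was written).  This
leaf uses only the §1–§3 interface of that module (`minPiece`, `sibling`, `minPiece_mul_le`, `LipProfile.…`,
`LipSlotLedger`, `SiblingSuppression`, `lipWeight`, `shellWeightBound_of_lipProfile`; byte-identical in v1.1/v1.2) and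
handles MIXED polarities through `Pol`; for a pure small-field family `pieceAt_le_sibAt` is A1's
`minPiece_profile_mul_le_shell` (same shell `1[(1 − κ)θ − Δ ≤ u^A < θ]`; `Pol.shell_small_le_largeInd_lowered` = A1's
`shellBelow_le_largeInd_lowered`), and for a large-field slot `Pol.fac_sub_min_le` SHARPENS A2's
`LipProfile.one_sub_profile_sub_min_le_layer` (layer `[(1 − κ)θ − Δ, θ + Δ)`, width `κθ + 2Δ`) to the record's R-η-2
shell `[(1 − κ)θ, θ + Δ)` (width `κθ + Δ`: a positive mismatch of the complementary factor forces `χ(u^A/θ) < 1`, i.e.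
`u^A > (1 − κ)θ`) — `Pol.shell_large_le_layer` records the domination, so every bound booked on A2's layer covers ours.

Deliberately NOT here: (F∞) itself (node U1b, `T4EtaRateMin` / `T4OutputRate`; NOT PRINTED); `SiblingSuppression` (NE7b
species: `T4PersistentHistoryCount`, `T4ShellMeasure`; NOT PRINTED as a ratio statement); the admissible transition
widths `κ(a)` and the size of `L(a)` (`T4LipschitzCutoff` §4–§6, record §5.2: `L_χ(a) = 2^{a+O(1)}/β²`); whether the
(η) price is absorbable at every `K` (the γ-clause margin, `T4ShellSuppressionRoute` §7, t4-ne7-p2 — under (η) the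
margin is constants / ḡ-uniformity, not existence: `Σ_K Wsh_K ≤ C₀·Σρ` is finite for any finite `C₀`,
`T4LipschitzCutoff.tsum_weight_le_of_printedShapes`, and `W + Wsh < 1` holds EVENTUALLY whenever `W ≤ W̄ < 1`
eventually, since `ShellWeightBound.summable` forces `Wsh → 0` — Mathlib `Summable.tendsto_atTop_zero`; the every-`K`
form `hlt` below is the binder `cauchy_of_relWeightBound_shell` takes, a tail version shifts the origin); the
single-run re-read under (η) (Q-η-1, Q-η-2 of the record; t4-ne7c-p2 §7); which factors of a (2.18)/(1.104)-term are
background-mediated slots (`t4/T4-XREAD-U5X15.md` §1).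
-/

open Finset MeasureTheory _root_.Filter _root_.Topology

namespace Literature.MathematicalPhysics.QuantumFieldTheory.Balaban1983to89.T4LipschitzLedger

open T4IndicatorShell T4LipschitzCutoff T4WeightBudget T4HybridMatching T4CauchySum

/-! ## §1 Polarity and the pointwise slot calculus -/

section Pointwise

/-- POLARITY of a profile slot factor: a small-field function `χ_a(u/θ)` or a large-field function `1 − χ_a(u/θ)` (the
two kinds of characteristic-function factors of a term, cf. the decompositions of unity `1 = χ + (1 − χ)` of
[Balaban1989LargeFieldI] (1.21)–(1.23) p. 181; rule R-η-2 of the record). [folklore] -/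
inductive Pol
  | small
  | large
  deriving DecidableEq

namespace Pol

/-- The factor's value as a function of the profile value `x = χ_a(u/θ)`: `x` (small) / `1 − x` (large). [folklore] -/
def fac : Pol → ℝ → ℝ
  | small, x => x
  | large, x => 1 - x

/-- THE SAME-RUN SHELL on which a mismatch of the polarity can live, for threshold `θ`, transition width `κ` and two-run
distance `Δ`: small — `1[(1 − κ)θ − Δ ≤ u < θ]` (rule R-η-1); large — `1[(1 − κ)θ ≤ u < θ + Δ]` (rule R-η-2).  Both are
`T4IndicatorShell.shellBelow` windows of width `κθ + Δ`. [folklore] -/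
noncomputable def shell : Pol → ℝ → ℝ → ℝ → ℝ → ℝ
  | small, u, θ, κ, Δ => shellBelow u θ (κ * θ + Δ)
  | large, u, θ, κ, Δ => shellBelow u (θ + Δ) (κ * θ + Δ)

/-- unfolding: the small polarity's factor is the profile value. [folklore] -/
@[simp] theorem fac_small (x : ℝ) : small.fac x = x := rfl

/-- unfolding: the large polarity's factor is the complementary value. [folklore] -/
@[simp] theorem fac_large (x : ℝ) : large.fac x = 1 - x := rfl

/-- unfolding: the small polarity's shell `1[(1 − κ)θ − Δ ≤ u < θ]` (rule R-η-1). [folklore] -/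
@[simp] theorem shell_small (u θ κ Δ : ℝ) : small.shell u θ κ Δ = shellBelow u θ (κ * θ + Δ) := rfl

/-- unfolding: the large polarity's shell `1[(1 − κ)θ ≤ u < θ + Δ]` (rule R-η-2). [folklore] -/
@[simp] theorem shell_large (u θ κ Δ : ℝ) : large.shell u θ κ Δ = shellBelow u (θ + Δ) (κ * θ + Δ) := rfl

/-- Either polarity maps `[0, 1]` to `[0, 1]`: nonnegativity. [folklore] -/
theorem fac_nonneg {x : ℝ} (h0 : 0 ≤ x) (h1 : x ≤ 1) : ∀ p : Pol, 0 ≤ p.fac x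
  | small => h0
  | large => by simp only [fac_large]; linarith

/-- … and the upper bound. [folklore] -/
theorem fac_le_one {x : ℝ} (h0 : 0 ≤ x) (h1 : x ≤ 1) : ∀ p : Pol, p.fac x ≤ 1
  | small => h1
  | large => by simp only [fac_large]; linarith

/-- Either polarity is a measurable (affine) function of the profile value. [folklore] -/
theorem measurable_fac : ∀ p : Pol, Measurable p.fac
  | small => measurable_id
  | large => measurable_const.sub measurable_id

/-- The shells are nonnegative … [folklore] -/
theorem shell_nonneg (u θ κ Δ : ℝ) : ∀ p : Pol, 0 ≤ p.shell u θ κ Δ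
  | small => shellBelow_nonneg _ _ _
  | large => shellBelow_nonneg _ _ _

end Pol

/-- a `shellBelow` window indicator is at most `1`. [folklore] -/
theorem shellBelow_le_one (u θ Δ : ℝ) : shellBelow u θ Δ ≤ 1 := by
  unfold shellBelow
  split_ifs <;> norm_num

/-- … and at most `1`. [folklore] -/
theorem Pol.shell_le_one (u θ κ Δ : ℝ) : ∀ p : Pol, p.shell u θ κ Δ ≤ 1
  | .small => shellBelow_le_one _ _ _
  | .large => shellBelow_le_one _ _ _

/-- a `shellBelow` window indicator is a measurable function of the tested variable. [folklore] -/
theorem measurable_shellBelow {Ω : Type*} [MeasurableSpace Ω] {U : Ω → ℝ} (hU : Measurable U) (θ Δ : ℝ) :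
    Measurable fun v => shellBelow (U v) θ Δ := by
  unfold shellBelow
  refine Measurable.ite ?_ measurable_const measurable_const
  exact (measurableSet_le measurable_const hU).inter (measurableSet_lt hU measurable_const)

/-- … hence so is either polarity's shell. [folklore] -/
theorem Pol.measurable_shell {Ω : Type*} [MeasurableSpace Ω] {U : Ω → ℝ} (hU : Measurable U) (θ κ Δ : ℝ) :
    ∀ p : Pol, Measurable fun v => p.shell (U v) θ κ Δ
  | .small => measurable_shellBelow hU _ _
  | .large => measurable_shellBelow hU _ _

/-- CONSISTENCY (A1 of `T4LipschitzCutoff` §6): the small polarity's shell is dominated by the lowered same-run large-field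
indicator `1[u ≥ (1 − κ)θ − Δ]` (the statement of `T4LipschitzCutoff.shellBelow_le_largeInd_lowered`, re-proved here so
that this leaf elaborates against the §1–§3 interface alone). [folklore] -/
theorem Pol.shell_small_le_largeInd_lowered (u θ κ Δ : ℝ) :
    Pol.small.shell u θ κ Δ ≤ largeInd u ((1 - κ) * θ - Δ) := by
  simp only [Pol.shell_small]
  unfold shellBelow largeInd
  have : θ - (κ * θ + Δ) = (1 - κ) * θ - Δ := by ring
  rw [this]
  by_cases hlow : (1 - κ) * θ - Δ ≤ u <;> by_cases htop : u < θ <;> simp [hlow, htop]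

/-- CONSISTENCY (A2 of `T4LipschitzCutoff` §6): the large polarity's R-η-2 shell `1[(1 − κ)θ ≤ u < θ + Δ]` is dominated by
the layer `1[(1 − κ)θ − Δ ≤ u < θ + Δ]` of `LipProfile.one_sub_profile_sub_min_le_layer` (for `Δ ≥ 0`). [folklore] -/
theorem Pol.shell_large_le_layer (u θ κ : ℝ) {Δ : ℝ} (hΔ : 0 ≤ Δ) :
    Pol.large.shell u θ κ Δ ≤ shellBelow u (θ + Δ) (κ * θ + 2 * Δ) := by
  simp only [Pol.shell_large]
  unfold shellBelow
  by_cases h1 : θ + Δ - (κ * θ + Δ) ≤ u ∧ u < θ + Δ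
  · have h2 : θ + Δ - (κ * θ + 2 * Δ) ≤ u ∧ u < θ + Δ := ⟨by linarith [h1.1], h1.2⟩
    rw [if_pos h1, if_pos h2]
  · rw [if_neg h1]
    split_ifs <;> norm_num

/-- **THE MISMATCH VALUE OF EITHER POLARITY IS `≤ L·(Δ/θ) ×` ITS SAME-RUN SHELL.**  For a profile `χ` of width `κ` and
Lipschitz constant `L`, `θ > 0`, `|u^A − u^B| ≤ Δ`: `p^A − min(p^A, p^B) ≤ L·(Δ/θ)·shell_p(u^A)` where `p^X = p.fac (χ(u^X/θ))`.
Small polarity: `T4LipschitzCutoff.LipProfile.profile_sub_min_le_shell` verbatim (rule R-η-1).  Large polarity (rule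
R-η-2; sharpens `LipProfile.one_sub_profile_sub_min_le_layer` by the bottom `Δ`): a positive mismatch needs
`χ(u^A/θ) < χ(u^B/θ)`, hence `χ(u^A/θ) < 1` (so `u^A > (1 − κ)θ`) and `χ(u^B/θ) > 0` (so `u^B < θ`, `u^A < θ + Δ`), and
its value is `≤ |χ(u^B/θ) − χ(u^A/θ)| ≤ L·Δ/θ` (`LipProfile.abs_profile_sub_profile_le`). [folklore] -/
theorem Pol.fac_sub_min_le {χ : ℝ → ℝ} {κ L : ℝ} (h : LipProfile χ κ L) {θ : ℝ} (hθ : 0 < θ) {uA uB Δ : ℝ}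
    (hΔ : |uA - uB| ≤ Δ) : ∀ p : Pol,
    p.fac (χ (uA / θ)) - min (p.fac (χ (uA / θ))) (p.fac (χ (uB / θ))) ≤ L * (Δ / θ) * p.shell uA θ κ Δ
  | .small => h.profile_sub_min_le_shell hθ hΔ
  | .large => by
    have hΔ0 : 0 ≤ Δ := (abs_nonneg _).trans hΔ
    have hnn : 0 ≤ L * (Δ / θ) * shellBelow uA (θ + Δ) (κ * θ + Δ) :=
      mul_nonneg (mul_nonneg h.L_pos.le (div_nonneg hΔ0 hθ.le)) (shellBelow_nonneg _ _ _)
    simp only [Pol.fac_large, Pol.shell_large]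
    rcases le_or_gt (χ (uB / θ)) (χ (uA / θ)) with hle | hlt
    · rw [min_eq_left (by linarith), sub_self]
      exact hnn
    · rw [min_eq_right (by linarith)]
      have hval : χ (uB / θ) - χ (uA / θ) ≤ L * (Δ / θ) :=
        (le_abs_self _).trans (h.abs_profile_sub_profile_le hθ (abs_sub_comm_le hΔ))
      have hsh : shellBelow uA (θ + Δ) (κ * θ + Δ) = 1 := by
        unfold shellBelow
        rw [if_pos]
        constructor
        · by_contra hlow
          have h1 : χ (uA / θ) = 1 := h.eq_one _ (by
            rw [div_le_iff₀ hθ]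
            have : (1 - κ) * θ = θ + Δ - (κ * θ + Δ) := by ring
            rw [this]
            exact (not_le.1 hlow).le)
          linarith [h.le_one (uB / θ)]
        · by_contra hup
          have huB : θ ≤ uB := by linarith [(abs_le.1 hΔ).2, not_lt.1 hup]
          have h0 : χ (uB / θ) = 0 := h.eq_zero _ (by rwa [le_div_iff₀ hθ, one_mul])
          linarith [h.nonneg (uA / θ)]
      rw [hsh, mul_one]
      linarith

variable {χ : ℕ → ℝ → ℝ} {κ Lχ : ℕ → ℝ} {sl : ℕ → Σ _ : ℕ, ℕ} {pol : ℕ → Pol} {θ uA uB : ℕ → ℝ} {m : ℕ}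

/-- THE SLOT FACTOR FAMILY of a run at one point of the integration space: factor `i` has age `(sl i).1`, polarity
`pol i`, threshold `θ i` and tested value `u i`; its value is `(pol i).fac (χ_{(sl i).1} (u i / θ i))`. [folklore] -/
noncomputable def facAt (χ : ℕ → ℝ → ℝ) (sl : ℕ → Σ _ : ℕ, ℕ) (pol : ℕ → Pol) (θ u : ℕ → ℝ) (i : ℕ) : ℝ :=
  (pol i).fac (χ (sl i).1 (u i / θ i))

/-- THE COMMON MIN-CORE of the two runs' factor families: `∏_{i<m} min(p^A_i, p^B_i)`. [folklore] -/
noncomputable def coreAt (χ : ℕ → ℝ → ℝ) (sl : ℕ → Σ _ : ℕ, ℕ) (pol : ℕ → Pol) (θ uA uB : ℕ → ℝ) (m : ℕ) : ℝ :=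
  ∏ i ∈ range m, min (facAt χ sl pol θ uA i) (facAt χ sl pol θ uB i)

/-- THE MIN-PIECE of factor `i` (`T4LipschitzCutoff.minPiece` of the run's family with the min-core). [folklore] -/
noncomputable def pieceAt (χ : ℕ → ℝ → ℝ) (sl : ℕ → Σ _ : ℕ, ℕ) (pol : ℕ → Pol) (θ uA uB : ℕ → ℝ) (m i : ℕ) : ℝ :=
  minPiece (facAt χ sl pol θ uA) (fun i => min (facAt χ sl pol θ uA i) (facAt χ sl pol θ uB i)) m i

/-- THE SHELL-RESTRICTED SIBLING of factor `i` at relative width `w` (rules R-η-1 / R-η-2): the polarity's same-run shell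
of width `κ_a θ_i + w θ_i` times `T4LipschitzCutoff.sibling` (the run's family with factor `i` removed). [folklore] -/
noncomputable def sibAt (χ : ℕ → ℝ → ℝ) (κ : ℕ → ℝ) (sl : ℕ → Σ _ : ℕ, ℕ) (pol : ℕ → Pol) (θ uA : ℕ → ℝ) (w : ℝ)
    (m i : ℕ) : ℝ :=
  (pol i).shell (uA i) (θ i) (κ (sl i).1) (w * θ i) * sibling (facAt χ sl pol θ uA) m i

/-- slot factors of profile families lie in `[0, 1]`: nonnegativity. [folklore] -/
theorem facAt_nonneg (hχ : ∀ a, LipProfile (χ a) (κ a) (Lχ a)) {u : ℕ → ℝ} (i : ℕ) : 0 ≤ facAt χ sl pol θ u i :=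
  Pol.fac_nonneg ((hχ _).nonneg _) ((hχ _).le_one _) _

/-- … and the upper bound. [folklore] -/
theorem facAt_le_one (hχ : ∀ a, LipProfile (χ a) (κ a) (Lχ a)) {u : ℕ → ℝ} (i : ℕ) : facAt χ sl pol θ u i ≤ 1 :=
  Pol.fac_le_one ((hχ _).nonneg _) ((hχ _).le_one _) _

/-- the min-core hypotheses of `T4LipschitzCutoff` §1 hold: `0 ≤ min(p^A_i, p^B_i) ≤ p^A_i`. [folklore] -/
theorem min_core_hyps (hχ : ∀ a, LipProfile (χ a) (κ a) (Lχ a)) :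
    (∀ i < m, 0 ≤ min (facAt χ sl pol θ uA i) (facAt χ sl pol θ uB i)) ∧
      (∀ i < m, min (facAt χ sl pol θ uA i) (facAt χ sl pol θ uB i) ≤ facAt χ sl pol θ uA i) :=
  ⟨fun i _ => le_min (facAt_nonneg hχ i) (facAt_nonneg hχ i), fun _ _ => min_le_left _ _⟩

/-- the core is nonnegative … [folklore] -/
theorem coreAt_nonneg (hχ : ∀ a, LipProfile (χ a) (κ a) (Lχ a)) : 0 ≤ coreAt χ sl pol θ uA uB m :=
  prod_nonneg fun i _ => le_min (facAt_nonneg hχ i) (facAt_nonneg hχ i)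

/-- … and at most `1`. [folklore] -/
theorem coreAt_le_one (hχ : ∀ a, LipProfile (χ a) (κ a) (Lχ a)) : coreAt χ sl pol θ uA uB m ≤ 1 :=
  prod_le_one (fun i _ => le_min (facAt_nonneg hχ i) (facAt_nonneg hχ i))
    fun i _ => (min_le_left _ _).trans (facAt_le_one hχ i)

/-- THE CORE IS COMMON TO BOTH RUNS (`T4LipschitzCutoff.prod_min_comm`). [folklore] -/
theorem coreAt_comm : coreAt χ sl pol θ uA uB m = coreAt χ sl pol θ uB uA m :=
  prod_min_comm _ _ _

/-- the run's full factor product is at most `1`. [folklore] -/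
theorem prod_facAt_le_one (hχ : ∀ a, LipProfile (χ a) (κ a) (Lχ a)) : ∏ i ∈ range m, facAt χ sl pol θ uA i ≤ 1 :=
  prod_le_one (fun i _ => facAt_nonneg hχ i) fun i _ => facAt_le_one hχ i

/-- min-pieces are nonnegative (`T4LipschitzCutoff.minPiece_nonneg`). [folklore] -/
theorem pieceAt_nonneg (hχ : ∀ a, LipProfile (χ a) (κ a) (Lχ a)) {i : ℕ} (hi : i < m) :
    0 ≤ pieceAt χ sl pol θ uA uB m i :=
  minPiece_nonneg (min_core_hyps hχ).1 (min_core_hyps hχ).2 hi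

/-- **THE MIN-CORE SPLIT at a point**: `Σ_{i<m} pieceAt_i = ∏_{i<m} p^A_i − coreAt` (`T4LipschitzCutoff.sum_minPiece_eq`).
[folklore] -/
theorem sum_pieceAt_eq :
    ∑ i ∈ range m, pieceAt χ sl pol θ uA uB m i = ∏ i ∈ range m, facAt χ sl pol θ uA i - coreAt χ sl pol θ uA uB m :=
  sum_minPiece_eq _ _ _

/-- the total of the min-pieces is at most the run's product, hence at most `1`. [folklore] -/
theorem sum_pieceAt_le_one (hχ : ∀ a, LipProfile (χ a) (κ a) (Lχ a)) :
    ∑ i ∈ range m, pieceAt χ sl pol θ uA uB m i ≤ 1 :=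
  (sum_minPiece_le_prod (min_core_hyps (sl := sl) (pol := pol) (θ := θ) (uA := uA) (uB := uB) hχ).1).trans
    (prod_facAt_le_one hχ)

/-- a single min-piece is at most `1`. [folklore] -/
theorem pieceAt_le_one (hχ : ∀ a, LipProfile (χ a) (κ a) (Lχ a)) {i : ℕ} (hi : i < m) :
    pieceAt χ sl pol θ uA uB m i ≤ 1 :=
  (single_le_sum (f := fun i => pieceAt χ sl pol θ uA uB m i) (fun _ hj => pieceAt_nonneg hχ (mem_range.1 hj))
    (mem_range.2 hi)).trans (sum_pieceAt_le_one hχ)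

/-- siblings of profile families lie in `[0, 1]`. [folklore] -/
theorem sibling_le_one (hχ : ∀ a, LipProfile (χ a) (κ a) (Lχ a)) (i : ℕ) : sibling (facAt χ sl pol θ uA) m i ≤ 1 := by
  unfold sibling
  refine mul_le_one₀ (prod_le_one (fun j _ => facAt_nonneg hχ j) fun j _ => facAt_le_one hχ j)
    (prod_nonneg fun j _ => facAt_nonneg hχ j) (prod_le_one (fun j _ => facAt_nonneg hχ j) fun j _ => facAt_le_one hχ j)

/-- shell-restricted siblings are nonnegative … [folklore] -/
theorem sibAt_nonneg (hχ : ∀ a, LipProfile (χ a) (κ a) (Lχ a)) {w : ℝ} {i : ℕ} (hi : i < m) :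
    0 ≤ sibAt χ κ sl pol θ uA w m i :=
  mul_nonneg (Pol.shell_nonneg _ _ _ _ _) (sibling_nonneg (fun j _ => facAt_nonneg hχ j) hi)

/-- … and at most `1`. [folklore] -/
theorem sibAt_le_one (hχ : ∀ a, LipProfile (χ a) (κ a) (Lχ a)) {w : ℝ} {i : ℕ} (hi : i < m) :
    sibAt χ κ sl pol θ uA w m i ≤ 1 :=
  mul_le_one₀ (Pol.shell_le_one _ _ _ _ _) (sibling_nonneg (fun j _ => facAt_nonneg hχ j) hi) (sibling_le_one hχ i)

/-- **POINTWISE, PER FACTOR: the min-piece is (Lipschitz constant × relative width) × the shell-restricted sibling.**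
Under the two-run closeness `|u^A_i − u^B_i| ≤ w·θ_i` (with `θ_i > 0`): `pieceAt_i ≤ L(a_i)·w·sibAt_i` — from
`T4LipschitzCutoff.minPiece_mul_le` (domination by the unrestricted sibling times the mismatch value) and
`Pol.fac_sub_min_le` (the mismatch value is `≤ L·w ×` the same-run shell).  Rules R-η-1 / R-η-2. [folklore] -/
theorem pieceAt_le_sibAt (hχ : ∀ a, LipProfile (χ a) (κ a) (Lχ a)) {w : ℝ} {i : ℕ} (hi : i < m) (hθ : 0 < θ i)
    (hw : |uA i - uB i| ≤ w * θ i) :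
    pieceAt χ sl pol θ uA uB m i ≤ Lχ (sl i).1 * w * sibAt χ κ sl pol θ uA w m i := by
  have hsib : 0 ≤ sibling (facAt χ sl pol θ uA) m i := sibling_nonneg (fun j _ => facAt_nonneg hχ j) hi
  have h1 : pieceAt χ sl pol θ uA uB m i ≤
      (facAt χ sl pol θ uA i - min (facAt χ sl pol θ uA i) (facAt χ sl pol θ uB i)) *
        sibling (facAt χ sl pol θ uA) m i := by
    have := minPiece_mul_le (p := facAt χ sl pol θ uA)
      (c := fun j => min (facAt χ sl pol θ uA j) (facAt χ sl pol θ uB j)) (min_core_hyps hχ).1 (min_core_hyps hχ).2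
      hi zero_le_one
    rw [mul_one, mul_one] at this
    exact this
  have h2 : facAt χ sl pol θ uA i - min (facAt χ sl pol θ uA i) (facAt χ sl pol θ uB i) ≤
      Lχ (sl i).1 * (w * θ i / θ i) * (pol i).shell (uA i) (θ i) (κ (sl i).1) (w * θ i) :=
    Pol.fac_sub_min_le (hχ _) hθ hw (pol i)
  rw [mul_div_assoc, div_self hθ.ne', mul_one] at h2
  calc pieceAt χ sl pol θ uA uB m i ≤ _ := h1
    _ ≤ (Lχ (sl i).1 * w * (pol i).shell (uA i) (θ i) (κ (sl i).1) (w * θ i)) * sibling (facAt χ sl pol θ uA) m i :=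
        mul_le_mul_of_nonneg_right h2 hsib
    _ = Lχ (sl i).1 * w * sibAt χ κ sl pol θ uA w m i := by unfold sibAt; ring

end Pointwise

/-! ## §2 Measurability and integrability of the slot calculus -/

section Measurability

/-- A Lipschitz profile is continuous. [folklore] -/
theorem continuous_profile {χ : ℝ → ℝ} {κ L : ℝ} (h : LipProfile χ κ L) : Continuous χ := by
  have hL : LipschitzWith (Real.toNNReal L) χ := by
    refine LipschitzWith.of_dist_le_mul fun a b => ?_
    rw [Real.dist_eq, Real.dist_eq, Real.coe_toNNReal L h.L_pos.le]
    exact h.lip a b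
  exact hL.continuous

variable {Ω : Type*} [MeasurableSpace Ω] {χ : ℕ → ℝ → ℝ} {κ Lχ : ℕ → ℝ} {sl : ℕ → Σ _ : ℕ, ℕ} {pol : ℕ → Pol}
  {θ : ℕ → ℝ} {UA UB : ℕ → Ω → ℝ} {m : ℕ}

/-- the slot factor `v ↦ p_i(v)` is measurable for a measurable tested variable. [folklore] -/
theorem measurable_facAt (hχ : ∀ a, LipProfile (χ a) (κ a) (Lχ a)) {i : ℕ} (hU : Measurable (UA i)) :
    Measurable fun v => facAt χ sl pol θ (fun j => UA j v) i := by
  unfold facAt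
  exact (Pol.measurable_fac _).comp ((continuous_profile (hχ _)).measurable.comp (hU.div_const _))

/-- the min-core is measurable. [folklore] -/
theorem measurable_coreAt (hχ : ∀ a, LipProfile (χ a) (κ a) (Lχ a)) (hA : ∀ i < m, Measurable (UA i))
    (hB : ∀ i < m, Measurable (UB i)) :
    Measurable fun v => coreAt χ sl pol θ (fun j => UA j v) (fun j => UB j v) m := by
  unfold coreAt
  refine Finset.measurable_prod _ fun i hi => ?_
  exact (measurable_facAt hχ (hA i (mem_range.1 hi))).min (measurable_facAt hχ (hB i (mem_range.1 hi)))

/-- the min-pieces are measurable. [folklore] -/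
theorem measurable_pieceAt (hχ : ∀ a, LipProfile (χ a) (κ a) (Lχ a)) (hA : ∀ i < m, Measurable (UA i))
    (hB : ∀ i < m, Measurable (UB i)) {i : ℕ} (hi : i < m) :
    Measurable fun v => pieceAt χ sl pol θ (fun j => UA j v) (fun j => UB j v) m i := by
  unfold pieceAt minPiece
  refine ((Finset.measurable_prod _ fun j hj => ?_).mul ?_).mul (Finset.measurable_prod _ fun j hj => ?_)
  · have hj' : j < m := (mem_range.1 hj).trans hi
    exact (measurable_facAt hχ (hA j hj')).min (measurable_facAt hχ (hB j hj'))
  · exact (measurable_facAt hχ (hA i hi)).sub ((measurable_facAt hχ (hA i hi)).min (measurable_facAt hχ (hB i hi)))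
  · exact measurable_facAt hχ (hA j (mem_Ico.1 hj).2)

/-- the shell-restricted siblings are measurable. [folklore] -/
theorem measurable_sibAt (hχ : ∀ a, LipProfile (χ a) (κ a) (Lχ a)) (hA : ∀ i < m, Measurable (UA i)) {w : ℝ} {i : ℕ}
    (hi : i < m) : Measurable fun v => sibAt χ κ sl pol θ (fun j => UA j v) w m i := by
  unfold sibAt sibling
  refine (Pol.measurable_shell (hA i hi) _ _ _ _).mul
    ((Finset.measurable_prod _ fun j hj => ?_).mul (Finset.measurable_prod _ fun j hj => ?_))
  · exact measurable_facAt hχ (hA j ((mem_range.1 hj).trans hi))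
  · exact measurable_facAt hχ (hA j (mem_Ico.1 hj).2)

/-- A `[0, 1]`-valued measurable factor times an integrable remainder is integrable (`Integrable.bdd_mul`). [folklore] -/
theorem integrable_unitInterval_mul {μ : Measure Ω} {f R : Ω → ℝ} (hR : Integrable R μ) (hf : Measurable f)
    (h0 : ∀ v, 0 ≤ f v) (h1 : ∀ v, f v ≤ 1) : Integrable (fun v => f v * R v) μ :=
  hR.bdd_mul hf.aestronglyMeasurable (ae_of_all _ fun v => by
    rw [Real.norm_eq_abs, abs_of_nonneg (h0 v)]; exact h1 v)

end Measurability

/-! ## §3 The realized ledger of one run -/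

section Realized

variable {ι : Type*} {Ω : ℕ → ι → Type*} [∀ K τ, MeasurableSpace (Ω K τ)]

/-- **REPRESENTATION CONVENTION OF ONE RUN** (a `structure … : Prop`; the SHAPE of B14 (2.18) p. 257 under design (η),
cell bookkeeping, NOT a printed statement and not an estimate).  The run's term weights `X K t τ` (`τ ∈ T K`,
`|t| ≤ l₀`) are Bochner integrals over a measurable space `Ω K τ` with reference measure `μ K τ` of the product of the
term's `m K τ` PROFILE SLOT FACTORS — factor `i` of age `(slot K τ i).1 ≤ min(N, K)` (so its level `K − a` exists and the
slot lies in the window `(range (N+1)).sigma (a ↦ range (n a))` of `T4LipschitzCutoff`), copy index `(slot K τ i).2`,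
polarity `pol K τ i`, threshold `θ K τ i > 0`, profile `χ_a` with `LipProfile (χ a) (κ a) (Lχ a)`, MEASURABLE tested
variables `uX K τ i` (this run) and `uY K τ i` (the other run, on the same space — the coupling of node U5a) — times a
NONNEGATIVE INTEGRABLE remainder `RX K t τ` collecting every other factor of the term (actions, boundary terms, pending
operations, the observable insert: the `t`-dependence lives here). [folklore] -/
structure TermRepr (l₀ : ℝ) (T : ℕ → Finset ι) (X : ℕ → ℝ → ι → ℝ) (χ : ℕ → ℝ → ℝ) (κ Lχ : ℕ → ℝ) (N : ℕ)
    (n : ℕ → ℕ) (μ : (K : ℕ) → (τ : ι) → Measure (Ω K τ)) (m : ℕ → ι → ℕ) (slot : ℕ → ι → ℕ → Σ _ : ℕ, ℕ)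
    (pol : ℕ → ι → ℕ → Pol) (θ : ℕ → ι → ℕ → ℝ) (uX uY : (K : ℕ) → (τ : ι) → ℕ → Ω K τ → ℝ)
    (RX : (K : ℕ) → ℝ → (τ : ι) → Ω K τ → ℝ) : Prop where
  /-- the profiles, one per age, are Lipschitz cut-off profiles -/
  profile : ∀ a, LipProfile (χ a) (κ a) (Lχ a)
  /-- thresholds are positive -/
  thr_pos : ∀ K, ∀ τ ∈ T K, ∀ i < m K τ, 0 < θ K τ i
  /-- every factor's slot lies in the window of ages `≤ N` and copies `< n a` -/
  slot_mem : ∀ K, ∀ τ ∈ T K, ∀ i < m K τ, slot K τ i ∈ (range (N + 1)).sigma fun a => range (n a)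
  /-- the age cap: a factor's age never exceeds the number of steps of the run -/
  slot_band : ∀ K, ∀ τ ∈ T K, ∀ i < m K τ, (slot K τ i).1 ≤ K
  /-- the tested variables of both runs are measurable on the common space -/
  meas : ∀ K, ∀ τ ∈ T K, ∀ i < m K τ, Measurable (uX K τ i) ∧ Measurable (uY K τ i)
  /-- the remainder is nonnegative almost everywhere … -/
  rem_nonneg : ∀ K t, |t| ≤ l₀ → ∀ τ ∈ T K, 0 ≤ᵐ[μ K τ] RX K t τ
  /-- … and integrable -/
  rem_int : ∀ K t, |t| ≤ l₀ → ∀ τ ∈ T K, Integrable (RX K t τ) (μ K τ)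
  /-- the representation of the term weight -/
  repr : ∀ K t, |t| ≤ l₀ → ∀ τ ∈ T K, X K t τ =
    ∫ v, (∏ i ∈ range (m K τ), facAt χ (slot K τ) (pol K τ) (θ K τ) (fun j => uX K τ j v) i) * RX K t τ v ∂(μ K τ)

/-- NAMED HYPOTHESIS SHAPE (F∞) IN RELATIVE FORM (node U1b; NOT PRINTED — print has one run and η-uniform regularity,
`t4/T4-XREAD-U1b.md`): almost everywhere on the term's space, the two runs' tested variables of factor `i` differ by at
most `ρ(K − a_i)·θ_i`, `ρ` indexed by the LEVEL `K − a_i` of the slot. A BINDER of every theorem below. [folklore] -/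
def SupClose (T : ℕ → Finset ι) (μ : (K : ℕ) → (τ : ι) → Measure (Ω K τ)) (m : ℕ → ι → ℕ)
    (slot : ℕ → ι → ℕ → Σ _ : ℕ, ℕ) (θ : ℕ → ι → ℕ → ℝ) (uX uY : (K : ℕ) → (τ : ι) → ℕ → Ω K τ → ℝ)
    (ρ : ℕ → ℝ) : Prop :=
  ∀ K, ∀ τ ∈ T K, ∀ i < m K τ, ∀ᵐ v ∂(μ K τ), |uX K τ i v - uY K τ i v| ≤ ρ (K - (slot K τ i).1) * θ K τ i

/-- (F∞) is symmetric in the two runs. [folklore] -/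
theorem SupClose.symm {T : ℕ → Finset ι} {μ : (K : ℕ) → (τ : ι) → Measure (Ω K τ)} {m : ℕ → ι → ℕ}
    {slot : ℕ → ι → ℕ → Σ _ : ℕ, ℕ} {θ : ℕ → ι → ℕ → ℝ} {uX uY : (K : ℕ) → (τ : ι) → ℕ → Ω K τ → ℝ} {ρ : ℕ → ℝ}
    (h : SupClose T μ m slot θ uX uY ρ) : SupClose T μ m slot θ uY uX ρ := fun K τ hτ i hi =>
  (h K τ hτ i hi).mono fun _ hv => abs_sub_comm_le hv

/-- THE REALIZED MIN-PIECE WEIGHT OF SLOT `σ` in term `τ` of the run at `(K, t)`: the sum, over the term's factors assigned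
to `σ`, of `∫ pieceAt_i · R dμ` (DEFINED, not postulated; empty — hence `0` — if no factor of `τ` sits in slot `σ`).
[folklore] -/
noncomputable def pieceW (χ : ℕ → ℝ → ℝ) (μ : (K : ℕ) → (τ : ι) → Measure (Ω K τ)) (m : ℕ → ι → ℕ)
    (slot : ℕ → ι → ℕ → Σ _ : ℕ, ℕ) (pol : ℕ → ι → ℕ → Pol) (θ : ℕ → ι → ℕ → ℝ)
    (uX uY : (K : ℕ) → (τ : ι) → ℕ → Ω K τ → ℝ) (RX : (K : ℕ) → ℝ → (τ : ι) → Ω K τ → ℝ)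
    (σ : Σ _ : ℕ, ℕ) (K : ℕ) (t : ℝ) (τ : ι) : ℝ :=
  ∑ i ∈ range (m K τ) with slot K τ i = σ,
    ∫ v, pieceAt χ (slot K τ) (pol K τ) (θ K τ) (fun j => uX K τ j v) (fun j => uY K τ j v) (m K τ) i * RX K t τ v
      ∂(μ K τ)

/-- THE REALIZED SHELL-RESTRICTED SIBLING WEIGHT OF SLOT `σ` (rules R-η-1 / R-η-2): the same sum with `sibAt_i` at the
relative width `ρ(K − a_i)` of the factor's level. [folklore] -/
noncomputable def sibW (χ : ℕ → ℝ → ℝ) (κ : ℕ → ℝ) (μ : (K : ℕ) → (τ : ι) → Measure (Ω K τ)) (m : ℕ → ι → ℕ)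
    (slot : ℕ → ι → ℕ → Σ _ : ℕ, ℕ) (pol : ℕ → ι → ℕ → Pol) (θ : ℕ → ι → ℕ → ℝ)
    (uX : (K : ℕ) → (τ : ι) → ℕ → Ω K τ → ℝ) (RX : (K : ℕ) → ℝ → (τ : ι) → Ω K τ → ℝ) (ρ : ℕ → ℝ)
    (σ : Σ _ : ℕ, ℕ) (K : ℕ) (t : ℝ) (τ : ι) : ℝ :=
  ∑ i ∈ range (m K τ) with slot K τ i = σ,
    ∫ v, sibAt χ κ (slot K τ) (pol K τ) (θ K τ) (fun j => uX K τ j v) (ρ (K - (slot K τ i).1)) (m K τ) i * RX K t τ v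
      ∂(μ K τ)

/-- THE REALIZED CORE WEIGHT of term `τ`: `∫ coreAt · R dμ`. [folklore] -/
noncomputable def coreW (χ : ℕ → ℝ → ℝ) (μ : (K : ℕ) → (τ : ι) → Measure (Ω K τ)) (m : ℕ → ι → ℕ)
    (slot : ℕ → ι → ℕ → Σ _ : ℕ, ℕ) (pol : ℕ → ι → ℕ → Pol) (θ : ℕ → ι → ℕ → ℝ)
    (uX uY : (K : ℕ) → (τ : ι) → ℕ → Ω K τ → ℝ) (RX : (K : ℕ) → ℝ → (τ : ι) → Ω K τ → ℝ)
    (K : ℕ) (t : ℝ) (τ : ι) : ℝ :=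
  ∫ v, coreAt χ (slot K τ) (pol K τ) (θ K τ) (fun j => uX K τ j v) (fun j => uY K τ j v) (m K τ) * RX K t τ v ∂(μ K τ)

/-- THE REALIZED TOTAL SHELL PART of term `τ`: `Σ_{i<m} ∫ pieceAt_i · R dμ` — the `shA` / `shB` of
`T4IndicatorShell.ShellWeightBound`. [folklore] -/
noncomputable def shellW (χ : ℕ → ℝ → ℝ) (μ : (K : ℕ) → (τ : ι) → Measure (Ω K τ)) (m : ℕ → ι → ℕ)
    (slot : ℕ → ι → ℕ → Σ _ : ℕ, ℕ) (pol : ℕ → ι → ℕ → Pol) (θ : ℕ → ι → ℕ → ℝ)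
    (uX uY : (K : ℕ) → (τ : ι) → ℕ → Ω K τ → ℝ) (RX : (K : ℕ) → ℝ → (τ : ι) → Ω K τ → ℝ)
    (K : ℕ) (t : ℝ) (τ : ι) : ℝ :=
  ∑ i ∈ range (m K τ),
    ∫ v, pieceAt χ (slot K τ) (pol K τ) (θ K τ) (fun j => uX K τ j v) (fun j => uY K τ j v) (m K τ) i * RX K t τ v
      ∂(μ K τ)

variable {l₀ : ℝ} {T : ℕ → Finset ι} {X : ℕ → ℝ → ι → ℝ} {χ : ℕ → ℝ → ℝ} {κ Lχ : ℕ → ℝ} {N : ℕ} {n : ℕ → ℕ}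
  {μ : (K : ℕ) → (τ : ι) → Measure (Ω K τ)} {m : ℕ → ι → ℕ} {slot : ℕ → ι → ℕ → Σ _ : ℕ, ℕ}
  {pol : ℕ → ι → ℕ → Pol} {θ : ℕ → ι → ℕ → ℝ} {uX uY : (K : ℕ) → (τ : ι) → ℕ → Ω K τ → ℝ}
  {RX : (K : ℕ) → ℝ → (τ : ι) → Ω K τ → ℝ} {ρ : ℕ → ℝ}

namespace TermRepr

/-- integrability of `pieceAt_i · R`. [folklore] -/
theorem integrable_piece (h : TermRepr l₀ T X χ κ Lχ N n μ m slot pol θ uX uY RX) {K : ℕ} {t : ℝ} (ht : |t| ≤ l₀)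
    {τ : ι} (hτ : τ ∈ T K) {i : ℕ} (hi : i < m K τ) :
    Integrable (fun v => pieceAt χ (slot K τ) (pol K τ) (θ K τ) (fun j => uX K τ j v) (fun j => uY K τ j v) (m K τ) i
      * RX K t τ v) (μ K τ) :=
  integrable_unitInterval_mul (h.rem_int K t ht τ hτ)
    (measurable_pieceAt h.profile (fun j hj => (h.meas K τ hτ j hj).1) (fun j hj => (h.meas K τ hτ j hj).2) hi)
    (fun _ => pieceAt_nonneg h.profile hi) fun _ => pieceAt_le_one h.profile hi

/-- integrability of `sibAt_i · R`. [folklore] -/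
theorem integrable_sib (h : TermRepr l₀ T X χ κ Lχ N n μ m slot pol θ uX uY RX) {K : ℕ} {t : ℝ} (ht : |t| ≤ l₀)
    {τ : ι} (hτ : τ ∈ T K) {i : ℕ} (hi : i < m K τ) (w : ℝ) :
    Integrable (fun v => sibAt χ κ (slot K τ) (pol K τ) (θ K τ) (fun j => uX K τ j v) w (m K τ) i * RX K t τ v)
      (μ K τ) :=
  integrable_unitInterval_mul (h.rem_int K t ht τ hτ)
    (measurable_sibAt h.profile (fun j hj => (h.meas K τ hτ j hj).1) hi)
    (fun _ => sibAt_nonneg h.profile hi) fun _ => sibAt_le_one h.profile hi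

/-- integrability of `coreAt · R`. [folklore] -/
theorem integrable_core (h : TermRepr l₀ T X χ κ Lχ N n μ m slot pol θ uX uY RX) {K : ℕ} {t : ℝ} (ht : |t| ≤ l₀)
    {τ : ι} (hτ : τ ∈ T K) :
    Integrable (fun v => coreAt χ (slot K τ) (pol K τ) (θ K τ) (fun j => uX K τ j v) (fun j => uY K τ j v) (m K τ)
      * RX K t τ v) (μ K τ) :=
  integrable_unitInterval_mul (h.rem_int K t ht τ hτ)
    (measurable_coreAt h.profile (fun j hj => (h.meas K τ hτ j hj).1) fun j hj => (h.meas K τ hτ j hj).2)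
    (fun _ => coreAt_nonneg h.profile) fun _ => coreAt_le_one h.profile

/-- integrability of the full integrand `(∏ p^X_i) · R`. [folklore] -/
theorem integrable_prod (h : TermRepr l₀ T X χ κ Lχ N n μ m slot pol θ uX uY RX) {K : ℕ} {t : ℝ} (ht : |t| ≤ l₀)
    {τ : ι} (hτ : τ ∈ T K) :
    Integrable (fun v => (∏ i ∈ range (m K τ), facAt χ (slot K τ) (pol K τ) (θ K τ) (fun j => uX K τ j v) i)
      * RX K t τ v) (μ K τ) :=
  integrable_unitInterval_mul (h.rem_int K t ht τ hτ)
    (Finset.measurable_prod _ fun i hi => measurable_facAt h.profile (h.meas K τ hτ i (mem_range.1 hi)).1)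
    (fun _ => prod_nonneg fun i _ => facAt_nonneg h.profile i) fun _ => prod_facAt_le_one h.profile

/-- `LipSlotLedger.piece_nonneg`: realized min-piece weights are nonnegative. [folklore] -/
theorem pieceW_nonneg (h : TermRepr l₀ T X χ κ Lχ N n μ m slot pol θ uX uY RX) (σ : Σ _ : ℕ, ℕ) (K : ℕ) (t : ℝ)
    (ht : |t| ≤ l₀) (τ : ι) (hτ : τ ∈ T K) : 0 ≤ pieceW χ μ m slot pol θ uX uY RX σ K t τ := by
  unfold pieceW
  refine sum_nonneg fun i hi => integral_nonneg_of_ae ?_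
  have hi' : i < m K τ := mem_range.1 (mem_filter.1 hi).1
  filter_upwards [h.rem_nonneg K t ht τ hτ] with v hv
  exact mul_nonneg (pieceAt_nonneg h.profile hi') hv

/-- the realized total shell part is nonnegative. [folklore] -/
theorem shellW_nonneg (h : TermRepr l₀ T X χ κ Lχ N n μ m slot pol θ uX uY RX) (K : ℕ) (t : ℝ) (ht : |t| ≤ l₀)
    (τ : ι) (hτ : τ ∈ T K) : 0 ≤ shellW χ μ m slot pol θ uX uY RX K t τ := by
  unfold shellW
  refine sum_nonneg fun i hi => integral_nonneg_of_ae ?_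
  filter_upwards [h.rem_nonneg K t ht τ hτ] with v hv
  exact mul_nonneg (pieceAt_nonneg h.profile (mem_range.1 hi)) hv

/-- the realized core weight is nonnegative. [folklore] -/
theorem coreW_nonneg (h : TermRepr l₀ T X χ κ Lχ N n μ m slot pol θ uX uY RX) (K : ℕ) (t : ℝ) (ht : |t| ≤ l₀)
    (τ : ι) (hτ : τ ∈ T K) : 0 ≤ coreW χ μ m slot pol θ uX uY RX K t τ := by
  unfold coreW
  refine integral_nonneg_of_ae ?_
  filter_upwards [h.rem_nonneg K t ht τ hτ] with v hv
  exact mul_nonneg (coreAt_nonneg h.profile) hv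

/-- **THE CORE IDENTITY**: `X − shellW = coreW` — the term minus its realized total shell part is the integral of the
common min-core against the run's remainder (linearity of the integral + the pointwise split `sum_pieceAt_eq`).
[folklore] -/
theorem repr_sub_shellW (h : TermRepr l₀ T X χ κ Lχ N n μ m slot pol θ uX uY RX) (K : ℕ) (t : ℝ) (ht : |t| ≤ l₀)
    (τ : ι) (hτ : τ ∈ T K) :
    X K t τ - shellW χ μ m slot pol θ uX uY RX K t τ = coreW χ μ m slot pol θ uX uY RX K t τ := by
  unfold shellW coreW
  rw [h.repr K t ht τ hτ, ← integral_finsetSum _ fun i hi => h.integrable_piece ht hτ (mem_range.1 hi),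
    ← integral_sub (h.integrable_prod ht hτ)]
  · refine integral_congr_ae (ae_of_all _ fun v => ?_)
    simp only
    rw [← sum_mul, sum_pieceAt_eq]
    ring
  · exact (integrable_finsetSum _ fun i hi => h.integrable_piece ht hτ (mem_range.1 hi))

/-- `shellW ≤ X` (the core weight is nonnegative). [folklore] -/
theorem shellW_le (h : TermRepr l₀ T X χ κ Lχ N n μ m slot pol θ uX uY RX) (K : ℕ) (t : ℝ) (ht : |t| ≤ l₀)
    (τ : ι) (hτ : τ ∈ T K) : shellW χ μ m slot pol θ uX uY RX K t τ ≤ X K t τ := by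
  have h1 := h.repr_sub_shellW K t ht τ hτ
  have h2 := h.coreW_nonneg K t ht τ hτ
  linarith

/-- a slot's realized weight is part of the total shell part. [folklore] -/
theorem pieceW_le_shellW (h : TermRepr l₀ T X χ κ Lχ N n μ m slot pol θ uX uY RX) (σ : Σ _ : ℕ, ℕ) (K : ℕ)
    (t : ℝ) (ht : |t| ≤ l₀) (τ : ι) (hτ : τ ∈ T K) :
    pieceW χ μ m slot pol θ uX uY RX σ K t τ ≤ shellW χ μ m slot pol θ uX uY RX K t τ := by
  unfold pieceW shellW
  refine sum_le_sum_of_subset_of_nonneg (filter_subset _ _) fun i hi _ => integral_nonneg_of_ae ?_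
  filter_upwards [h.rem_nonneg K t ht τ hτ] with v hv
  exact mul_nonneg (pieceAt_nonneg h.profile (mem_range.1 hi)) hv

/-- `LipSlotLedger.piece_le`: a slot's realized weight never exceeds the term. [folklore] -/
theorem pieceW_le (h : TermRepr l₀ T X χ κ Lχ N n μ m slot pol θ uX uY RX) (σ : Σ _ : ℕ, ℕ) (K : ℕ) (t : ℝ)
    (ht : |t| ≤ l₀) (τ : ι) (hτ : τ ∈ T K) : pieceW χ μ m slot pol θ uX uY RX σ K t τ ≤ X K t τ :=
  (h.pieceW_le_shellW σ K t ht τ hτ).trans (h.shellW_le K t ht τ hτ)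

/-- `LipSlotLedger.piece_offband`: in runs younger than the slot (`K < a`) no factor of any term sits in the slot — the
age cap `slot_band` — so the realized weight is an empty sum. [folklore] -/
theorem pieceW_offband (h : TermRepr l₀ T X χ κ Lχ N n μ m slot pol θ uX uY RX) (σ : Σ _ : ℕ, ℕ) (K : ℕ) (t : ℝ)
    (τ : ι) (hτ : τ ∈ T K) (hK : K < σ.1) : pieceW χ μ m slot pol θ uX uY RX σ K t τ ≤ 0 := by
  unfold pieceW
  refine (sum_eq_zero fun i hi => ?_).le
  obtain ⟨hi, hiσ⟩ := mem_filter.1 hi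
  have := h.slot_band K τ hτ i (mem_range.1 hi)
  rw [hiσ] at this
  exact absurd hK (not_lt.2 this)

/-- `LipSlotLedger.sib_nonneg`: realized sibling weights are nonnegative. [folklore] -/
theorem sibW_nonneg (h : TermRepr l₀ T X χ κ Lχ N n μ m slot pol θ uX uY RX) (ρ : ℕ → ℝ) (σ : Σ _ : ℕ, ℕ) (K : ℕ)
    (t : ℝ) (ht : |t| ≤ l₀) (τ : ι) (hτ : τ ∈ T K) : 0 ≤ sibW χ κ μ m slot pol θ uX RX ρ σ K t τ := by
  unfold sibW
  refine sum_nonneg fun i hi => integral_nonneg_of_ae ?_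
  have hi' : i < m K τ := mem_range.1 (mem_filter.1 hi).1
  filter_upwards [h.rem_nonneg K t ht τ hτ] with v hv
  exact mul_nonneg (sibAt_nonneg h.profile hi') hv

/-- `LipSlotLedger.piece_le_sib` — **THE INTEGRATION STEP**: under (F∞), slot `σ = ⟨a, i⟩`'s realized weight is at most
`L(a)·ρ(K − a) ×` its realized shell-restricted sibling weight (pointwise `pieceAt_le_sibAt` a.e., then
`integral_mono_ae`; it holds on and off the band). [folklore] -/
theorem pieceW_le_sibW (h : TermRepr l₀ T X χ κ Lχ N n μ m slot pol θ uX uY RX) (hF : SupClose T μ m slot θ uX uY ρ)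
    (σ : Σ _ : ℕ, ℕ) (K : ℕ) (t : ℝ) (ht : |t| ≤ l₀) (τ : ι) (hτ : τ ∈ T K) :
    pieceW χ μ m slot pol θ uX uY RX σ K t τ ≤ Lχ σ.1 * ρ (K - σ.1) * sibW χ κ μ m slot pol θ uX RX ρ σ K t τ := by
  unfold pieceW sibW
  rw [mul_sum]
  refine sum_le_sum fun i hi => ?_
  obtain ⟨hi, hiσ⟩ := mem_filter.1 hi
  have hi' : i < m K τ := mem_range.1 hi
  rw [← integral_const_mul]
  refine integral_mono_ae (h.integrable_piece ht hτ hi') ((h.integrable_sib ht hτ hi' _).const_mul _) ?_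
  filter_upwards [h.rem_nonneg K t ht τ hτ, hF K τ hτ i hi'] with v hv hclose
  have := pieceAt_le_sibAt (sl := slot K τ) (pol := pol K τ) (uA := fun j => uX K τ j v) (uB := fun j => uY K τ j v)
    (m := m K τ) h.profile hi' (h.thr_pos K τ hτ i hi') hclose
  rw [← hiσ]
  calc _ ≤ (Lχ (slot K τ i).1 * ρ (K - (slot K τ i).1) *
        sibAt χ κ (slot K τ) (pol K τ) (θ K τ) (fun j => uX K τ j v) (ρ (K - (slot K τ i).1)) (m K τ) i) * RX K t τ v :=
      mul_le_mul_of_nonneg_right this hv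
    _ = _ := by ring

/-- **THE UNION BOUND IS AN IDENTITY**: summed over the slot window, the realized slot weights of a term ARE its total
shell part (every factor's slot lies in the window; `Finset.sum_fiberwise_of_maps_to` — no injectivity of the slot
assignment is used). [folklore] -/
theorem sum_pieceW_eq_shellW (h : TermRepr l₀ T X χ κ Lχ N n μ m slot pol θ uX uY RX) (K : ℕ) (t : ℝ) (τ : ι)
    (hτ : τ ∈ T K) :
    ∑ σ ∈ (range (N + 1)).sigma (fun a => range (n a)), pieceW χ μ m slot pol θ uX uY RX σ K t τ =
      shellW χ μ m slot pol θ uX uY RX K t τ := by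
  unfold pieceW shellW
  exact sum_fiberwise_of_maps_to (fun i hi => h.slot_mem K τ hτ i (mem_range.1 hi)) _

end TermRepr

/-- **`LipSlotLedger` FROM THE REPRESENTATION AND (F∞).**  The five fields of `T4LipschitzCutoff.LipSlotLedger` hold for
the realized min-piece weights and the realized shell-restricted sibling weights of a represented run. [folklore] -/
theorem lipSlotLedger_of_repr (h : TermRepr l₀ T X χ κ Lχ N n μ m slot pol θ uX uY RX)
    (hF : SupClose T μ m slot θ uX uY ρ) :
    LipSlotLedger l₀ T X N n (pieceW χ μ m slot pol θ uX uY RX) (sibW χ κ μ m slot pol θ uX RX ρ) Lχ ρ where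
  piece_nonneg σ _ K t ht τ hτ := h.pieceW_nonneg σ K t ht τ hτ
  piece_le σ _ K t ht τ hτ := h.pieceW_le σ K t ht τ hτ
  piece_offband σ _ K t _ hK τ hτ := h.pieceW_offband σ K t τ hτ hK
  sib_nonneg σ _ K t ht τ hτ := h.sibW_nonneg ρ σ K t ht τ hτ
  piece_le_sib σ _ K t ht _ τ hτ := h.pieceW_le_sibW hF σ K t ht τ hτ

end Realized

/-! ## §4 Two runs: the common core, the core sandwich, and the corollaries by name -/

section TwoRuns

variable {ι : Type*} {Ω : ℕ → ι → Type*} [∀ K τ, MeasurableSpace (Ω K τ)]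
  {l₀ vol : ℝ} {T : ℕ → Finset ι} {A B : ℕ → ℝ → ι → ℝ} {χ : ℕ → ℝ → ℝ} {κ Lχ : ℕ → ℝ} {N : ℕ} {n : ℕ → ℕ}
  {μ : (K : ℕ) → (τ : ι) → Measure (Ω K τ)} {m : ℕ → ι → ℕ} {slot : ℕ → ι → ℕ → Σ _ : ℕ, ℕ}
  {pol : ℕ → ι → ℕ → Pol} {θ : ℕ → ι → ℕ → ℝ} {uA uB : (K : ℕ) → (τ : ι) → ℕ → Ω K τ → ℝ}
  {RA RB : (K : ℕ) → ℝ → (τ : ι) → Ω K τ → ℝ} {ρ S W δ : ℕ → ℝ} {Bad : ℕ → ℝ → Finset ι}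

/-- RUN B's CORE WEIGHT, written with run B's factors first, equals the integral of the core in run A's order against
run B's remainder (the min-core is symmetric, `coreAt_comm`). [folklore] -/
theorem coreW_comm (K : ℕ) (t : ℝ) (τ : ι) :
    coreW χ μ m slot pol θ uB uA RB K t τ =
      ∫ v, coreAt χ (slot K τ) (pol K τ) (θ K τ) (fun j => uA K τ j v) (fun j => uB K τ j v) (m K τ) * RB K t τ v
        ∂(μ K τ) := by
  unfold coreW
  refine integral_congr_ae (ae_of_all _ fun v => ?_)
  simp only
  rw [coreAt_comm]

/-- A COMMON NONNEGATIVE FACTOR PRESERVES AN a.e. TWO-SIDED SANDWICH UNDER THE INTEGRAL: if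
`e^{c−r} R^A ≤ R^B ≤ e^{c+r} R^A` a.e. and `f ≥ 0`, then `e^{c−r} ∫ f R^A ≤ ∫ f R^B ≤ e^{c+r} ∫ f R^A`
(`T4HybridMatching.integral_sandwich`). [folklore] -/
theorem integral_mul_sandwich {α : Type*} [MeasurableSpace α] {ν : Measure α} {f RA' RB' : α → ℝ} {c r : ℝ}
    (hf0 : ∀ v, 0 ≤ f v) (hIA : Integrable (fun v => f v * RA' v) ν) (hIB : Integrable (fun v => f v * RB' v) ν)
    (hlo : ∀ᵐ v ∂ν, Real.exp (c - r) * RA' v ≤ RB' v) (hhi : ∀ᵐ v ∂ν, RB' v ≤ Real.exp (c + r) * RA' v) :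
    Real.exp (c - r) * ∫ v, f v * RA' v ∂ν ≤ ∫ v, f v * RB' v ∂ν ∧
      ∫ v, f v * RB' v ∂ν ≤ Real.exp (c + r) * ∫ v, f v * RA' v ∂ν := by
  refine integral_sandwich hIA hIB ?_ ?_
  · filter_upwards [hlo] with v hv
    calc Real.exp (c - r) * (f v * RA' v) = f v * (Real.exp (c - r) * RA' v) := by ring
      _ ≤ f v * RB' v := mul_le_mul_of_nonneg_left hv (hf0 v)
  · filter_upwards [hhi] with v hv
    calc f v * RB' v ≤ f v * (Real.exp (c + r) * RA' v) := mul_le_mul_of_nonneg_left hv (hf0 v)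
      _ = Real.exp (c + r) * (f v * RA' v) := by ring

/-- **THE CORE SANDWICH** (the `hcore` input of `T4IndicatorShell.good_ref` / `cauchy_of_relWeightBound_shell` for the
realized shell parts).  If on every good term the two runs' REMAINDERS are sandwiched almost everywhere,
`e^{c_K − vol·δ_K} R^A ≤ R^B ≤ e^{c_K + vol·δ_K} R^A` (the output format of `T4RecentScale.density_sandwich` for the
term's remaining factor ledgers — a BINDER), then the CORE PIECES `A − shellW^A`, `B − shellW^B` are sandwiched with
the same constants: both are integrals of the COMMON nonnegative min-core against the respective remainders
(`repr_sub_shellW`, `coreW_comm`, `integral_mul_sandwich`). [folklore] -/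
theorem core_sandwich [DecidableEq ι] (hA : TermRepr l₀ T A χ κ Lχ N n μ m slot pol θ uA uB RA)
    (hB : TermRepr l₀ T B χ κ Lχ N n μ m slot pol θ uB uA RB) {c : ℕ → ℝ}
    (hsw : ∀ K t, |t| ≤ l₀ → ∀ τ ∈ T K \ Bad K t,
      (∀ᵐ v ∂(μ K τ), Real.exp (c K - vol * δ K) * RA K t τ v ≤ RB K t τ v) ∧
        (∀ᵐ v ∂(μ K τ), RB K t τ v ≤ Real.exp (c K + vol * δ K) * RA K t τ v)) :
    ∀ K : ℕ, ∃ c' : ℝ, ∀ t : ℝ, |t| ≤ l₀ → ∀ τ ∈ T K \ Bad K t,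
      Real.exp (c' - vol * δ K) * (A K t τ - shellW χ μ m slot pol θ uA uB RA K t τ) ≤
          B K t τ - shellW χ μ m slot pol θ uB uA RB K t τ ∧
        B K t τ - shellW χ μ m slot pol θ uB uA RB K t τ ≤
          Real.exp (c' + vol * δ K) * (A K t τ - shellW χ μ m slot pol θ uA uB RA K t τ) := by
  intro K
  refine ⟨c K, fun t ht τ hτ => ?_⟩
  have hτT : τ ∈ T K := (Finset.mem_sdiff.1 hτ).1
  obtain ⟨hlo, hhi⟩ := hsw K t ht τ hτ
  have hIB : Integrable (fun v => coreAt χ (slot K τ) (pol K τ) (θ K τ) (fun j => uA K τ j v) (fun j => uB K τ j v)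
      (m K τ) * RB K t τ v) (μ K τ) := by
    refine (hB.integrable_core ht hτT (K := K)).congr (ae_of_all _ fun v => ?_)
    simp only
    rw [coreAt_comm]
  rw [hA.repr_sub_shellW K t ht τ hτT, hB.repr_sub_shellW K t ht τ hτT,
    coreW_comm (uA := uA) (uB := uB) (RB := RB) K t τ]
  unfold coreW
  exact integral_mul_sandwich (fun v => coreAt_nonneg hA.profile) (hA.integrable_core ht hτT) hIB hlo hhi

/-- **THE CONSTRUCTOR OF DESIGN (η), REALIZED.**  Two represented runs on the common spaces (the same slot data, the
tested variables in either order), (F∞) in relative form with a nonnegative SUMMABLE width `ρ` (node U1b/U4′ — the only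
two-run input), and `SiblingSuppression` of the realized shell-restricted siblings in both runs (NE7b species, per age)
⇒ the literal `T4IndicatorShell.ShellWeightBound` for the realized total shell parts with the band weight
`K ↦ Σ_{a≤N} n_a · lipWeight L S ρ a K` — by `T4LipschitzCutoff.shellWeightBound_of_lipProfile`, whose two
`LipSlotLedger`s are now THEOREMS (`lipSlotLedger_of_repr`) and whose union bounds are identities
(`sum_pieceW_eq_shellW`). [folklore] -/
theorem shellWeightBound_of_repr (hA : TermRepr l₀ T A χ κ Lχ N n μ m slot pol θ uA uB RA)
    (hB : TermRepr l₀ T B χ κ Lχ N n μ m slot pol θ uB uA RB) (hF : SupClose T μ m slot θ uA uB ρ)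
    (hSA : SiblingSuppression l₀ T A N n (sibW χ κ μ m slot pol θ uA RA ρ) S)
    (hSB : SiblingSuppression l₀ T B N n (sibW χ κ μ m slot pol θ uB RB ρ) S)
    (hS : ∀ a ≤ N, 0 ≤ S a) (hρ0 : ∀ j, 0 ≤ ρ j) (hρ : Summable ρ) :
    ShellWeightBound l₀ T A B (shellW χ μ m slot pol θ uA uB RA) (shellW χ μ m slot pol θ uB uA RB)
      (fun K => ∑ a ∈ range (N + 1), (n a : ℝ) * lipWeight Lχ S ρ a K) :=
  shellWeightBound_of_lipProfile (lipSlotLedger_of_repr hA hF) (lipSlotLedger_of_repr hB hF.symm) hSA hSB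
    (fun a _ => (hA.profile a).L_pos.le) hS hρ0 hρ
    (fun K t ht τ hτ => hA.shellW_nonneg K t ht τ hτ) (fun K t ht τ hτ => hA.shellW_le K t ht τ hτ)
    (fun K t _ τ hτ => (hA.sum_pieceW_eq_shellW K t τ hτ).symm.le)
    (fun K t ht τ hτ => hB.shellW_nonneg K t ht τ hτ) (fun K t ht τ hτ => hB.shellW_le K t ht τ hτ)
    (fun K t _ τ hτ => (hB.sum_pieceW_eq_shellW K t τ hτ).symm.le)

/-- **END TO END UNDER DESIGN (η)** (CONDITIONAL kernel theorem; every estimate is a binder).  An NE7b output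
`RelWeightBound l₀ T A B Bad W`; two represented runs with (F∞) and sibling suppression as in
`shellWeightBound_of_repr`; the band weight small enough, `W K + Σ_a n_a·lipWeight L S ρ a K < 1`; the partition
functions `Z K t = Σ_τ A K t τ`, `Z (K+1) t = Σ_τ B K t τ` with `Σ_τ A K t τ > 0` (cell input L1-pos); summable `δ` (node
U4′); and the a.e. remainder sandwich on the good terms (node U5b's factor ledgers) ⇒ matching modulo constants with
remainders `hybridDelta vol δ (W + Wsh)`, their summability, the Cauchy property of every generating-function sequence on
`|t| ≤ l₀`, and uniform convergence there — `T4IndicatorShell.cauchy_of_relWeightBound_shell` fed by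
`shellWeightBound_of_repr` and `core_sandwich`.  Nothing of Bałaban's is asserted. [folklore] -/
theorem cauchy_of_repr [DecidableEq ι] {Z : ℕ → ℝ → ℝ} (hvol : 0 < vol) (hl₀ : 0 ≤ l₀)
    (hW : RelWeightBound l₀ T A B Bad W)
    (hA : TermRepr l₀ T A χ κ Lχ N n μ m slot pol θ uA uB RA) (hB : TermRepr l₀ T B χ κ Lχ N n μ m slot pol θ uB uA RB)
    (hF : SupClose T μ m slot θ uA uB ρ)
    (hSA : SiblingSuppression l₀ T A N n (sibW χ κ μ m slot pol θ uA RA ρ) S)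
    (hSB : SiblingSuppression l₀ T B N n (sibW χ κ μ m slot pol θ uB RB ρ) S)
    (hS : ∀ a ≤ N, 0 ≤ S a) (hρ0 : ∀ j, 0 ≤ ρ j) (hρ : Summable ρ)
    (hlt : ∀ K, W K + ∑ a ∈ range (N + 1), (n a : ℝ) * lipWeight Lχ S ρ a K < 1)
    (hZA : ∀ K t, |t| ≤ l₀ → Z K t = ∑ τ ∈ T K, A K t τ)
    (hZB : ∀ K t, |t| ≤ l₀ → Z (K + 1) t = ∑ τ ∈ T K, B K t τ)
    (hpos : ∀ K t, |t| ≤ l₀ → 0 < ∑ τ ∈ T K, A K t τ) (hδ : Summable δ) {c : ℕ → ℝ}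
    (hsw : ∀ K t, |t| ≤ l₀ → ∀ τ ∈ T K \ Bad K t,
      (∀ᵐ v ∂(μ K τ), Real.exp (c K - vol * δ K) * RA K t τ v ≤ RB K t τ v) ∧
        (∀ᵐ v ∂(μ K τ), RB K t τ v ≤ Real.exp (c K + vol * δ K) * RA K t τ v)) :
    MatchingModConstants vol l₀
        (hybridDelta vol δ (fun K => W K + ∑ a ∈ range (N + 1), (n a : ℝ) * lipWeight Lχ S ρ a K)) Z ∧
      Summable (hybridDelta vol δ (fun K => W K + ∑ a ∈ range (N + 1), (n a : ℝ) * lipWeight Lχ S ρ a K)) ∧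
      (∀ t : ℝ, |t| ≤ l₀ → CauchySeq fun K => genFun Z K t) ∧
      TendstoUniformlyOn (fun K t => genFun Z K t) (genFunLim Z) atTop {t | |t| ≤ l₀} :=
  cauchy_of_relWeightBound_shell hvol hl₀ hW (shellWeightBound_of_repr hA hB hF hSA hSB hS hρ0 hρ) hlt hZA hZB hpos hδ
    (core_sandwich hA hB hsw)

end TwoRuns

/-! ## §5 Sanity: a NON-DEGENERATE inhabitant of the binders (non-vacuity; v1.1, append-only)

A TOY model — NOT Bałaban's terms, no print involved: one term per cutoff (`ι = Unit`), the integration space a point with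
the Dirac mass, ONE small-field profile factor per term of age `0` with the piecewise-linear profile of width `1/2`
(`T4LipschitzCutoff.linProfile`, Lipschitz constant `2`) and threshold `1`, remainder `1`; run A tests the value `3/4`
(inside the profile's transition layer), run B the value `3/4 + (1/2)^K/8` — a GEOMETRIC two-run width, the shape
node U1b's liaison `T4SupCloseLiaison.geomWidth` (pv25) delivers from `LocalRate` (named here, not imported).  THEN: both runs are represented
(`termRepr_A`, `termRepr_B`: weights `A = 1/2`, `B = 1/2 − (1/2)^K/4`), (F∞) holds with the SUMMABLE width
`ρ_j = (1/2)^j/8` (`supClose`), sibling suppression holds in both runs with `S = 4` (`siblingSuppression_A/_B`), so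
`shellWeightBound_of_repr` FIRES (`shellWeightBound_toy`); and the model is non-degenerate: run A's realized shell part is
`(1/2)^K/4 > 0` at EVERY cutoff (`shellW_A`, `shellW_A_pos`) and the band weight is exactly `(1/2)^K` (`bandWeight`) —
`= 1` at `K = 0`, `< 1` from `K₀ = 1` on, so the weight condition of the hybrid scheme holds on a TAIL only, which is what
the seam-(ζ′) socket `T4MatchingClosureSocket.hybridNE7_closure'_tail` consumes (no `lt_one` field; cell GAPS C-pv07-54).
PURPOSE: the fifteen-odd binders of §3–§4 are JOINTLY SATISFIABLE by non-trivial data — the conditional theorems above are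
not vacuous.  Nothing here is an estimate; nothing of Bałaban's is asserted. [folklore] -/

noncomputable section

namespace Sanity

/-- toy index of terms: one term per cutoff. [folklore] -/
def T : ℕ → Finset Unit := fun _ => {()}

/-- toy integration spaces: a point. [folklore] -/
abbrev Ω : ℕ → Unit → Type := fun _ _ => Unit

/-- toy reference measures: the Dirac mass. [folklore] -/
noncomputable def μ : (K : ℕ) → (τ : Unit) → Measure (Ω K τ) := fun _ _ => Measure.dirac ()

/-- toy profiles: the piecewise-linear profile of width `1/2` at every age. [folklore] -/
def χ : ℕ → ℝ → ℝ := fun _ => linProfile (1 / 2)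

/-- toy widths. [folklore] -/
def κ : ℕ → ℝ := fun _ => 1 / 2

/-- toy Lipschitz constants (`= 2`). [folklore] -/
noncomputable def Lχ : ℕ → ℝ := fun _ => (1 / 2 : ℝ)⁻¹

/-- toy copy counts: one slot per age. [folklore] -/
def n : ℕ → ℕ := fun _ => 1

/-- toy factor counts: one profile factor per term. [folklore] -/
def m : ℕ → Unit → ℕ := fun _ _ => 1

/-- toy slots: age `0`, copy `0`. [folklore] -/
def slot : ℕ → Unit → ℕ → Σ _ : ℕ, ℕ := fun _ _ _ => ⟨0, 0⟩

/-- toy polarities: small-field factors. [folklore] -/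
def pol : ℕ → Unit → ℕ → Pol := fun _ _ _ => Pol.small

/-- toy thresholds: `1`. [folklore] -/
def θ : ℕ → Unit → ℕ → ℝ := fun _ _ _ => 1

/-- run A's tested variable: `3/4`, inside the transition layer `(1/2, 1)` of the profile. [folklore] -/
def uA : (K : ℕ) → (τ : Unit) → ℕ → Ω K τ → ℝ := fun _ _ _ _ => 3 / 4

/-- run B's tested variable: `3/4 + (1/2)^K/8` — (F∞)-close to run A's with a summable width. [folklore] -/
noncomputable def uB : (K : ℕ) → (τ : Unit) → ℕ → Ω K τ → ℝ := fun K _ _ _ => 3 / 4 + (1 / 2 : ℝ) ^ K / 8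

/-- toy remainders: `1`. [folklore] -/
def R : (K : ℕ) → ℝ → (τ : Unit) → Ω K τ → ℝ := fun _ _ _ _ => 1

/-- the (F∞) width by level: `(1/2)^j/8`. [folklore] -/
noncomputable def ρ : ℕ → ℝ := fun j => (1 / 2 : ℝ) ^ j / 8

/-- the sibling-suppression constants: `4`. [folklore] -/
def S : ℕ → ℝ := fun _ => 4

/-- run A's term weights: `1/2`. [folklore] -/
noncomputable def A : ℕ → ℝ → Unit → ℝ := fun _ _ _ => 1 / 2

/-- run B's term weights: `1/2 − (1/2)^K/4`. [folklore] -/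
noncomputable def B : ℕ → ℝ → Unit → ℝ := fun K _ _ => 1 / 2 - (1 / 2 : ℝ) ^ K / 4

/-- `0 < (1/2)^K`. [folklore] -/
theorem half_pow_pos (K : ℕ) : 0 < (1 / 2 : ℝ) ^ K := pow_pos (by norm_num) K

/-- `(1/2)^K ≤ 1`. [folklore] -/
theorem half_pow_le_one (K : ℕ) : (1 / 2 : ℝ) ^ K ≤ 1 := pow_le_one₀ (by norm_num) (by norm_num)

/-- the profile value of run A's factor: `χ(3/4) = 1/2`. [folklore] -/
theorem profile_A : linProfile (1 / 2) (3 / 4 / 1) = 1 / 2 := by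
  have h : (1 - 3 / 4 / 1) / (1 / 2 : ℝ) = 1 / 2 := by norm_num
  rw [linProfile, h, min_eq_right (by norm_num), max_eq_right (by norm_num)]

/-- the profile value of run B's factor: `χ(3/4 + x/8) = 1/2 − x/4` for `x = (1/2)^K`. [folklore] -/
theorem profile_B (K : ℕ) : linProfile (1 / 2) ((3 / 4 + (1 / 2 : ℝ) ^ K / 8) / 1) = 1 / 2 - (1 / 2 : ℝ) ^ K / 4 := by
  have hx0 := half_pow_pos K
  have hx1 := half_pow_le_one K
  have h : (1 - (3 / 4 + (1 / 2 : ℝ) ^ K / 8) / 1) / (1 / 2 : ℝ) = 1 / 2 - (1 / 2 : ℝ) ^ K / 4 := by ring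
  rw [linProfile, h, min_eq_right (by linarith), max_eq_right (by linarith)]

/-- run A's slot factor is `1/2`. [folklore] -/
theorem facAt_A (K : ℕ) (v : Unit) :
    facAt χ (slot K ()) (pol K ()) (θ K ()) (fun j => uA K () j v) 0 = 1 / 2 := by
  simp only [facAt, pol, χ, θ, uA, Pol.fac_small]
  exact profile_A

/-- run B's slot factor is `1/2 − (1/2)^K/4`. [folklore] -/
theorem facAt_B (K : ℕ) (v : Unit) :
    facAt χ (slot K ()) (pol K ()) (θ K ()) (fun j => uB K () j v) 0 = 1 / 2 - (1 / 2 : ℝ) ^ K / 4 := by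
  simp only [facAt, pol, χ, θ, uB, Pol.fac_small]
  exact profile_B K

/-- the toy profiles are Lipschitz cut-off profiles (`linProfile_lipProfile`). [folklore] -/
theorem profiles : ∀ a, LipProfile (χ a) (κ a) (Lχ a) := fun _ =>
  linProfile_lipProfile (by norm_num) (by norm_num)

/-- **run A is represented.** [folklore] -/
theorem termRepr_A : TermRepr 1 T A χ κ Lχ 0 n μ m slot pol θ uA uB R where
  profile := profiles
  thr_pos K τ _ i _ := by simp [θ]
  slot_mem K τ _ i _ := by simp [slot, n, Finset.mem_sigma]
  slot_band K τ _ i _ := by simp [slot]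
  meas K τ _ i _ := ⟨measurable_const, measurable_const⟩
  rem_nonneg K t _ τ _ := ae_of_all _ fun v => by simp [R]
  rem_int K t _ τ _ := by simp only [μ]; exact integrable_const (1 : ℝ)
  repr K t _ τ _ := by
    obtain ⟨⟩ := τ
    simp only [μ, integral_dirac, m, prod_range_one, R, mul_one]
    rw [facAt_A]; rfl

/-- **run B is represented** (tested variables in the other order). [folklore] -/
theorem termRepr_B : TermRepr 1 T B χ κ Lχ 0 n μ m slot pol θ uB uA R where
  profile := profiles
  thr_pos K τ _ i _ := by simp [θ]
  slot_mem K τ _ i _ := by simp [slot, n, Finset.mem_sigma]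
  slot_band K τ _ i _ := by simp [slot]
  meas K τ _ i _ := ⟨measurable_const, measurable_const⟩
  rem_nonneg K t _ τ _ := ae_of_all _ fun v => by simp [R]
  rem_int K t _ τ _ := by simp only [μ]; exact integrable_const (1 : ℝ)
  repr K t _ τ _ := by
    obtain ⟨⟩ := τ
    simp only [μ, integral_dirac, m, prod_range_one, R, mul_one]
    rw [facAt_B]; rfl

/-- **(F∞) holds** with the summable width `ρ`. [folklore] -/
theorem supClose : SupClose T μ m slot θ uA uB ρ := fun K τ _ i _ => ae_of_all _ fun v => by
  simp only [uA, uB, slot, θ, ρ, Nat.sub_zero, mul_one]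
  rw [show (3 / 4 : ℝ) - (3 / 4 + (1 / 2 : ℝ) ^ K / 8) = -((1 / 2 : ℝ) ^ K / 8) by ring, abs_neg,
    abs_of_nonneg (by positivity)]

/-- the (F∞) width is summable (geometric). [folklore] -/
theorem summable_ρ : Summable ρ :=
  (summable_geometric_of_lt_one (by norm_num) (by norm_num : (1 / 2 : ℝ) < 1)).div_const 8

/-- the realized sibling weight of either run is at most `1` (one factor, remainder `1`, a point mass). [folklore] -/
theorem sibW_le_one {uX : (K : ℕ) → (τ : Unit) → ℕ → Ω K τ → ℝ} (σ : Σ _ : ℕ, ℕ) (K : ℕ) (t : ℝ) :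
    sibW χ κ μ m slot pol θ uX R ρ σ K t () ≤ 1 := by
  unfold sibW
  calc ∑ i ∈ range (m K ()) with slot K () i = σ,
        ∫ v, sibAt χ κ (slot K ()) (pol K ()) (θ K ()) (fun j => uX K () j v) (ρ (K - (slot K () i).1)) (m K ()) i *
          R K t () v ∂(μ K ())
      ≤ ∑ i ∈ range (m K ()),
        ∫ v, sibAt χ κ (slot K ()) (pol K ()) (θ K ()) (fun j => uX K () j v) (ρ (K - (slot K () i).1)) (m K ()) i *
          R K t () v ∂(μ K ()) := by
        refine sum_le_sum_of_subset_of_nonneg (filter_subset _ _) fun i hi _ => ?_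
        simp only [μ, integral_dirac, R, mul_one]
        exact sibAt_nonneg profiles (mem_range.1 hi)
    _ ≤ 1 := by
        simp only [μ, integral_dirac, R, mul_one, m, sum_range_one]
        exact sibAt_le_one profiles (by norm_num)

/-- **sibling suppression in run A** with `S = 4`: sibling weight `≤ 1 ≤ 4·(1/2)`. [folklore] -/
theorem siblingSuppression_A : SiblingSuppression 1 T A 0 n (sibW χ κ μ m slot pol θ uA R ρ) S := by
  intro σ _ K t _
  simp only [T, sum_singleton, S, A]
  linarith [sibW_le_one (uX := uA) σ K t]

/-- **sibling suppression in run B** with `S = 4`: sibling weight `≤ 1 ≤ 4·(1/2 − (1/2)^K/4)`. [folklore] -/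
theorem siblingSuppression_B : SiblingSuppression 1 T B 0 n (sibW χ κ μ m slot pol θ uB R ρ) S := by
  intro σ _ K t _
  simp only [T, sum_singleton, S, B]
  linarith [sibW_le_one (uX := uB) σ K t, half_pow_le_one K]

/-- **THE CONSTRUCTOR FIRES ON THE TOY DATA**: the literal `ShellWeightBound` of the realized shell parts, by
`shellWeightBound_of_repr`. [folklore] -/
theorem shellWeightBound_toy :
    ShellWeightBound 1 T A B (shellW χ μ m slot pol θ uA uB R) (shellW χ μ m slot pol θ uB uA R)
      (fun K => ∑ a ∈ range (0 + 1), (n a : ℝ) * lipWeight Lχ S ρ a K) :=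
  shellWeightBound_of_repr termRepr_A termRepr_B supClose siblingSuppression_A siblingSuppression_B
    (fun _ _ => by norm_num [S]) (fun j => by simp only [ρ]; positivity) summable_ρ

/-- NON-DEGENERACY: run A's realized shell part is `(1/2)^K/4 > 0` at EVERY cutoff. [folklore] -/
theorem shellW_A (K : ℕ) (t : ℝ) : shellW χ μ m slot pol θ uA uB R K t () = (1 / 2 : ℝ) ^ K / 4 := by
  have hx0 := half_pow_pos K
  have hx1 := half_pow_le_one K
  simp only [shellW, μ, integral_dirac, R, mul_one, m, sum_range_one, pieceAt, minPiece, range_zero, prod_empty,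
    one_mul, Finset.Ico_self, mul_one, facAt_A, facAt_B]
  rw [min_eq_right (by linarith)]
  ring

/-- … hence positive. [folklore] -/
theorem shellW_A_pos (K : ℕ) (t : ℝ) : 0 < shellW χ μ m slot pol θ uA uB R K t () := by
  rw [shellW_A]; exact div_pos (half_pow_pos K) (by norm_num)

/-- THE BAND WEIGHT of the toy is `(1/2)^K`: `< 1` exactly from `K₀ = 1` on — the socket's TAIL is genuinely needed.
[folklore] -/
theorem bandWeight (K : ℕ) : ∑ a ∈ range (0 + 1), (n a : ℝ) * lipWeight Lχ S ρ a K = (1 / 2 : ℝ) ^ K := by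
  simp only [zero_add, sum_range_one, n, Nat.cast_one, one_mul, lipWeight, Nat.zero_le, if_true, Lχ, S, ρ,
    Nat.sub_zero]
  ring

end Sanity

end

end Literature.MathematicalPhysics.QuantumFieldTheory.Balaban1983to89.T4LipschitzLedger
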